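import Summits.CriticalPhenomena.SAWScalingLimit.Theorems.SAWDefectDecoherenceBoundaryClosureRDevelopingMapOneScale
import Summits.CriticalPhenomena.SAWScalingLimit.Theorems.SAWDefectDecoherenceBoundaryClosureRDevelopingMapRiemann
import Summits.CriticalPhenomena.SAWScalingLimit.Theorems.SAWDefectDecoherenceBoundaryClosureRLocalL1SmoothToContinuous
import Summits.CriticalPhenomena.SAWScalingLimit.Theorems.SAWDevelopingMapPotentialExists
import HarnessLib

/-!
# The developing map against test functions: the limit along a mesh sequence
(crux `BoundaryClosureR`, stmt-CriticalPhenomena-14004, line `pick-half-plane`,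
stub `stub_developingMapLimitHolomorphic`)

THE CORE LIMIT (`core_limit`, registered helper `developingMapLimitHolomorphic_coreLimit`): for a
family of domains `Λ δ` exhausting the compacts of an open `U`, simply connected with boundary
root `e δ` and boundary normaliser `b δ` eventually, satisfying the local `L¹` law on compacts of
`U`, and a mesh sequence `ns → 0⁺` along which the normalised developing maps
`δ(H − H(s_b))/F(b δ)` converge uniformly on compacts of `U` to a continuous `h`: for every
`φ ∈ C²_c(U)` and weights `w` with frame constants `(A, B)`,

  `δ² Σ_{s ∈ T_δ} Σ_k φ(δ·mid(edge s k)) w_k F(edge s k)/F(b δ) → −(2/√3) ∫ h · (A ∂φ + B ∂̄φ)`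

along `δ = ns n`, where `T_δ` is the set of lattice sites within `2ε₀` of `tsupport φ` (for a
suitable `ε₀ > 0`, also returned, together with the eventual cover facts needed to rewrite the
double sum as a mid-edge sum).  Proof: `one_scale` at every large `n` (potentials exist by
`potentialExists_proof`), the Riemann sums `tendsto_triLattice_sum` for `h·Ψ`, and the counting
bound `developingMapLimitHolomorphic_riemann`.  References: Duminil-Copin–Smirnov (2012) §3.
-/

noncomputable section

open scoped BigOperators ComplexConjugate Topology NNReal Classical
open Filter Set Metric Complex MeasureTheory
open Literature.Probability.LatticeModels Literature.Probability.RandomPlanarGeometry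
open Literature.Probability.RandomPlanarGeometry.SAW
open Literature.Barriers.CriticalPhenomena Literature.Barriers.CriticalPhenomena.HexKernel
open Literature.Analysis.Complex (dbarAlong dbarAlong_one)
open Summit.CriticalPhenomena.SAWScalingLimit.Theorems.PickHalfPlane
open Summit.CriticalPhenomena.SAWScalingLimit.Theorems.PickHalfPlane.Hexagon
open Summit.CriticalPhenomena.SAWScalingLimit.Theorems.PickHalfPlane.Engine
open Summit.CriticalPhenomena.SAWScalingLimit.Theorems.PickHalfPlane.LocalL1
  (continuous_mul_of_tsupport_subset)

namespace Summit.CriticalPhenomena.SAWScalingLimit.Theorems.PickHalfPlane.DevelopingMap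

/-- A boundary normaliser has a base site: the two faces of a boundary mid-edge share a vertex.
[folklore] -/
theorem exists_base_site {S : Finset HexVertex} {bb : Sym2 HexVertex} (hb : bb ∈ hexDomainBoundary S) :
    ∃ (ub wb : HexVertex) (sb : Site 2), bb = s(ub, wb) ∧ sb ∈ hexFaceVertices ub ∧
      sb ∈ hexFaceVertices wb := by
  obtain ⟨hedge, u, v, rfl, -, -⟩ := hb
  have hadj : hexGraph.Adj u v := (SimpleGraph.mem_edgeSet hexGraph).1 hedge
  obtain ⟨sb, hsu, hsv⟩ := exists_mem_inter_of_card_eq_two ((hexGraph_adj_iff u v).1 hadj).2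
  exact ⟨u, v, sb, rfl, hsu, hsv⟩

/-- Potentials of `F dz` exist on simply connected domains with a boundary root
(`potentialExists_proof`, pool item stmt-CriticalPhenomena-8299). [folklore] -/
theorem exists_potential {S : Finset HexVertex} (hS : hexDomainSimplyConnected S) {a : Sym2 HexVertex}
    (ha : a ∈ hexDomainBoundary S) : ∃ H : Site 2 → ℂ, IsPotential S a H :=
  Summit.CriticalPhenomena.SAWScalingLimit.Theorems.potentialExists_proof S hS a ha

/-- **The core limit.**  See the module docstring. [folklore] -/
theorem core_limit (Λ : ℝ → Finset HexVertex) (e b : ℝ → Sym2 HexVertex) {U : Set ℂ} (hU : IsOpen U)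
    (hexh : ∀ K : Set ℂ, IsCompact K → K ⊆ U →
      ∀ᶠ δ : ℝ in 𝓝[>] 0, ∀ v : HexVertex, (δ : ℂ) * hexCenter v ∈ K → v ∈ Λ δ)
    (hbd : ∀ᶠ δ : ℝ in 𝓝[>] 0, hexDomainSimplyConnected (Λ δ) ∧ e δ ∈ hexDomainBoundary (Λ δ) ∧
      b δ ∈ hexDomainBoundary (Λ δ))
    (hL1 : ∀ K : Set ℂ, IsCompact K → K ⊆ U → ∃ C : ℝ, ∀ᶠ δ : ℝ in 𝓝[>] 0,
      δ ^ 2 * (∑ᶠ z ∈ {z : Sym2 HexVertex | z ∈ hexDomainMidEdges (Λ δ) ∧ (δ : ℂ) * hexMidpoint z ∈ K},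
        ‖hexParafermionicObservable (Λ δ) (e δ) hexCriticalFugacity (5 / 8) z‖) ≤
      C * ‖hexParafermionicObservable (Λ δ) (e δ) hexCriticalFugacity (5 / 8) (b δ)‖)
    {ns : ℕ → ℝ} (hns : Tendsto ns atTop (𝓝[>] 0))
    {h : ℂ → ℂ} (hh : ContinuousOn h U)
    (hconv : ∀ K : Set ℂ, IsCompact K → K ⊆ U → ∀ ε : ℝ, 0 < ε → ∀ᶠ n : ℕ in atTop,
      ∀ H : Site 2 → ℂ, IsPotential (Λ (ns n)) (e (ns n)) H →
      ∀ (ub wb : HexVertex), b (ns n) = s(ub, wb) →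
      ∀ sb : Site 2, sb ∈ hexFaceVertices ub → sb ∈ hexFaceVertices wb →
      ∀ s : Site 2, IsLatticeSite (Λ (ns n)) s → ((ns n : ℝ) : ℂ) * triEmbed s ∈ K →
        ‖((ns n : ℝ) : ℂ) * (H s - H sb) /
            hexParafermionicObservable (Λ (ns n)) (e (ns n)) hexCriticalFugacity (5 / 8) (b (ns n)) -
          h (((ns n : ℝ) : ℂ) * triEmbed s)‖ < ε)
    {φ : ℂ → ℂ} (hφ : ContDiff ℝ 2 φ) (hφc : HasCompactSupport φ) (hφU : tsupport φ ⊆ U)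
    (w : Fin 6 → ℂ) (hw : ∀ k, ‖w k‖ ≤ 1) (A B : ℂ)
    (hframe : ∀ P Q : ℂ, ∑ k : Fin 6, w k * (12 * conj (mvec k)) *
      (P * triEmbed (spoke 0 k) + Q * conj (triEmbed (spoke 0 k))) = A * P + B * Q) :
    ∃ ε₀ : ℝ, 0 < ε₀ ∧
      (∀ᶠ n : ℕ in atTop, ∀ (s : Site 2) (k : Fin 6),
        ((ns n : ℝ) : ℂ) * hexMidpoint (edge s k) ∈ cthickening ε₀ (tsupport φ) →
        s ∈ ((Λ (ns n)).biUnion hexFaceVertices).filter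
            (fun s => ((ns n : ℝ) : ℂ) * triEmbed s ∈ cthickening (2 * ε₀) (tsupport φ)) ∧
          face s k ∈ Λ (ns n) ∧ face s (k + 1) ∈ Λ (ns n)) ∧
      Tendsto (fun n => ((ns n : ℝ) : ℂ) ^ 2 *
        ∑ s ∈ ((Λ (ns n)).biUnion hexFaceVertices).filter
            (fun s => ((ns n : ℝ) : ℂ) * triEmbed s ∈ cthickening (2 * ε₀) (tsupport φ)),
          ∑ k : Fin 6, φ (((ns n : ℝ) : ℂ) * hexMidpoint (edge s k)) * w k *
            (hexParafermionicObservable (Λ (ns n)) (e (ns n)) hexCriticalFugacity (5 / 8) (edge s k) /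
              hexParafermionicObservable (Λ (ns n)) (e (ns n)) hexCriticalFugacity (5 / 8) (b (ns n))))
        atTop (𝓝 (-(((2 / Real.sqrt 3 : ℝ) : ℂ) *
          ∫ z, h z * (A * ((2 : ℂ)⁻¹ * (fderiv ℝ φ z 1 - I * fderiv ℝ φ z I)) + B * dbarAlong 1 φ z)))) := by
  ---------------------------------------------------------------- notation
  set K : Set ℂ := tsupport φ with hKdef
  have hK : IsCompact K := hφc
  set Ψ : ℂ → ℂ := fun z => A * ((2 : ℂ)⁻¹ * (fderiv ℝ φ z 1 - I * fderiv ℝ φ z I)) +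
    B * dbarAlong 1 φ z with hΨdef
  ---------------------------------------------------------------- room around the support
  obtain ⟨ε₁, hε₁, hε₁U⟩ := hK.exists_cthickening_subset_open hU hφU
  set ε₀ : ℝ := ε₁ / 3 with hε₀def
  have hε₀ : 0 < ε₀ := by positivity
  set K₁ : Set ℂ := cthickening ε₀ K with hK₁
  set K₂ : Set ℂ := cthickening (2 * ε₀) K with hK₂
  set K₃ : Set ℂ := cthickening (3 * ε₀) K with hK₃
  have hK₁c : IsCompact K₁ := hK.cthickening
  have hK₂c : IsCompact K₂ := hK.cthickening
  have hK₃c : IsCompact K₃ := hK.cthickening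
  have hK₃U : K₃ ⊆ U := by
    have : 3 * ε₀ = ε₁ := by rw [hε₀def]; ring
    rw [hK₃, this]; exact hε₁U
  have hK₂U : K₂ ⊆ U := (cthickening_mono (by linarith) K).trans hK₃U
  have hK₁U : K₁ ⊆ U := (cthickening_mono (by linarith) K).trans hK₃U
  have hKK₂ : K ⊆ K₂ := self_subset_cthickening K
  ---------------------------------------------------------------- constants of `φ`, `Ψ`, `h`
  obtain ⟨L, hL⟩ := hφ.lipschitzWith_of_hasCompactSupport hφc (by simp)
  obtain ⟨M, hM0, hM⟩ := taylor_bound hφ hφc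
  have hΨK : ∀ z, z ∉ K → Ψ z = 0 := fun z hz => wirtinger_eq_zero_of_notMem hz A B
  have hΨc : Continuous Ψ := by
    have hd : Continuous (fderiv ℝ φ) := hφ.continuous_fderiv (by simp)
    simp only [hΨdef, dbarAlong_one, smul_eq_mul]
    fun_prop
  have hΨcs : HasCompactSupport Ψ := HasCompactSupport.intro hK hΨK
  have hΨU : tsupport Ψ ⊆ U := (closure_minimal (fun z hz => by
    by_contra h'; exact hz (hΨK z h')) hK.isClosed).trans hφU
  obtain ⟨CΨ, hCΨ⟩ := hΨc.bounded_above_of_compact_support hΨcs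
  have hCΨ0 : 0 ≤ CΨ := (norm_nonneg _).trans (hCΨ 0)
  obtain ⟨Bh, hBh⟩ := hK₂c.exists_bound_of_continuousOn (hh.mono hK₂U)
  set Bh' : ℝ := max Bh 0 with hBh'
  obtain ⟨C₁, hC₁⟩ := hL1 K₁ hK₁c hK₁U
  set C₁' : ℝ := max C₁ 0 with hC₁'
  obtain ⟨N₁, hN₁⟩ := developingMapLimitHolomorphic_riemann K₁ hK₁c
  set N₁' : ℝ := max N₁ 0 with hN₁'
  ---------------------------------------------------------------- the sets of sites
  have hTmem : ∀ (S : Finset HexVertex) (δ : ℝ) (s : Site 2),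
      s ∈ (S.biUnion hexFaceVertices).filter (fun s => (δ : ℂ) * triEmbed s ∈ K₂) ↔
        IsLatticeSite S s ∧ (δ : ℂ) * triEmbed s ∈ K₂ := fun S δ s => by
    simp only [Finset.mem_filter, Finset.mem_biUnion, IsLatticeSite]
  ---------------------------------------------------------------- events along the mesh sequence
  have hns0 : Tendsto ns atTop (𝓝 0) := hns.mono_right nhdsWithin_le_nhds
  have hev_pos : ∀ᶠ n in atTop, ns n ∈ Ioo (0 : ℝ) ε₀ := hns.eventually (Ioo_mem_nhdsGT hε₀)
  have hev_exh : ∀ᶠ n in atTop, ∀ v : HexVertex, ((ns n : ℝ) : ℂ) * hexCenter v ∈ K₃ → v ∈ Λ (ns n) :=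
    hns.eventually (hexh K₃ hK₃c hK₃U)
  have hev_L1 := hns.eventually hC₁
  have hev_bd := hns.eventually hbd
  have hev_N := hns.eventually hN₁
  refine ⟨ε₀, hε₀, ?_, ?_⟩
  · filter_upwards [hev_pos, hev_exh] with n hn hexn s k hsk
    exact (sites_setup (Λ (ns n)) K hε₀ hn.1 hn.2.le hexn _ (hTmem (Λ (ns n)) (ns n))).2.2 s k hsk
  ---------------------------------------------------------------- the Riemann part
  set X : ℕ → ℂ := fun n => ((ns n : ℝ) : ℂ) ^ 2 *
    ∑ s ∈ ((Λ (ns n)).biUnion hexFaceVertices).filter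
        (fun s => ((ns n : ℝ) : ℂ) * triEmbed s ∈ K₂),
      ∑ k : Fin 6, φ (((ns n : ℝ) : ℂ) * hexMidpoint (edge s k)) * w k *
        (hexParafermionicObservable (Λ (ns n)) (e (ns n)) hexCriticalFugacity (5 / 8) (edge s k) /
          hexParafermionicObservable (Λ (ns n)) (e (ns n)) hexCriticalFugacity (5 / 8) (b (ns n)))
    with hXdef
  set R : ℕ → ℂ := fun n => ((ns n : ℝ) : ℂ) ^ 2 *
    ∑ s ∈ ((Λ (ns n)).biUnion hexFaceVertices).filter
        (fun s => ((ns n : ℝ) : ℂ) * triEmbed s ∈ K₂),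
      h (((ns n : ℝ) : ℂ) * triEmbed s) * Ψ (((ns n : ℝ) : ℂ) * triEmbed s) with hRdef
  have hprod_c : Continuous fun z => h z * Ψ z := by
    have := continuous_mul_of_tsupport_subset hU subset_rfl hΨc hΨU hh
    simpa only [mul_comm] using this
  have hprod_cs : HasCompactSupport fun z => h z * Ψ z := hΨcs.mul_left
  have hR : Tendsto R atTop (𝓝 (((2 / Real.sqrt 3 : ℝ) : ℂ) * ∫ z, h z * Ψ z)) := by
    refine ((tendsto_triLattice_sum hprod_c hprod_cs).comp hns).congr' ?_
    filter_upwards [hev_pos, hev_exh] with n hn hexn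
    simp only [Function.comp_apply, hRdef]
    congr 1
    refine finsum_eq_sum_of_support_subset _ fun s hs => ?_
    have hsK : ((ns n : ℝ) : ℂ) * triEmbed s ∈ K := by
      by_contra h'
      exact hs (by simp only [hΨK _ h', mul_zero])
    exact (sites_setup (Λ (ns n)) K hε₀ hn.1 hn.2.le hexn _ (hTmem (Λ (ns n)) (ns n))).1 s
      (hKK₂ hsK) |>.2
  ---------------------------------------------------------------- the claim: `X + R → 0`
  have hclaim : ∀ ε' : ℝ, 0 < ε' → ∀ᶠ n in atTop, ‖X n + R n‖ ≤ ε' := by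
    intro ε' hε'
    set Cst : ℝ := (L : ℝ) * C₁' + 24 * M * (Bh' + 1) * N₁' with hCst
    set η : ℝ := min 1 (ε' / (2 * (CΨ * N₁' + 1))) with hηdef
    have hN0 : 0 ≤ N₁' := le_max_right _ _
    have hη : 0 < η := lt_min one_pos (by positivity)
    have hη1 : η ≤ 1 := min_le_left _ _
    have hηb : η * CΨ * N₁' ≤ ε' / 2 := by
      have h1 : η ≤ ε' / (2 * (CΨ * N₁' + 1)) := min_le_right _ _
      have h2 : 0 ≤ CΨ * N₁' := by positivity
      calc η * CΨ * N₁' = η * (CΨ * N₁') := by ring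
        _ ≤ ε' / (2 * (CΨ * N₁' + 1)) * (CΨ * N₁') := mul_le_mul_of_nonneg_right h1 h2
        _ ≤ ε' / 2 := by
            rw [div_mul_eq_mul_div, div_le_div_iff₀ (by positivity) (by positivity)]
            nlinarith
    have hev_conv := hconv K₂ hK₂c hK₂U η hη
    have hev_small : ∀ᶠ n in atTop, ns n * Cst ≤ ε' / 2 := by
      have : Tendsto (fun n => ns n * Cst) atTop (𝓝 (0 * Cst)) := hns0.mul_const Cst
      rw [zero_mul] at this
      exact this.eventually (eventually_le_nhds (half_pos hε'))
    filter_upwards [hev_pos, hev_exh, hev_L1, hev_bd, hev_N, hev_conv, hev_small] with n hn hexn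
      hL1n hbdn hNn hconvn hsmall
    -- objects at the scale `δ = ns n`
    obtain ⟨hsc, he, hb⟩ := hbdn
    obtain ⟨H, hH⟩ := exists_potential hsc he
    obtain ⟨ub, wb, sb, hbuw, hsbu, hsbw⟩ := exists_base_site hb
    set δ : ℝ := ns n with hδdef
    set Fδ : Sym2 HexVertex → ℂ := hexParafermionicObservable (Λ δ) (e δ) hexCriticalFugacity (5 / 8)
      with hFδ
    set hhn : Site 2 → ℂ := fun s => (δ : ℂ) * (H s - H sb) / Fδ (b δ) with hhhn
    have hHF : ∀ (s : Site 2) (k : Fin 6), IsInteriorSite (Λ δ) s →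
        hhn (spoke s k) - hhn s = mvec k * ((δ : ℂ) * (Fδ (edge s k) / Fδ (b δ))) := by
      intro s k hs
      have hinc := potential_increment hH hs k
      have e1 : H (spoke s k) - H sb = (H s - H sb) + mvec k * Fδ (edge s k) := by
        rw [← hinc]; ring
      simp only [hhhn]
      rw [e1]; ring
    have hL1n' : δ ^ 2 * (∑ᶠ z ∈ {z : Sym2 HexVertex | z ∈ hexDomainMidEdges (Λ δ) ∧
        (δ : ℂ) * hexMidpoint z ∈ cthickening ε₀ (tsupport φ)}, ‖Fδ z‖) ≤ C₁' * ‖Fδ (b δ)‖ :=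
      hL1n.trans (mul_le_mul_of_nonneg_right (le_max_left _ _) (norm_nonneg _))
    have hNn' : ∀ T' : Finset (Site 2), (∀ s ∈ T', (δ : ℂ) * triEmbed s ∈ cthickening ε₀ (tsupport φ)) →
        δ ^ 2 * (T'.card : ℝ) ≤ N₁' := fun T' hT' => (hNn T' hT').trans (le_max_left _ _)
    have hBhK : ∀ z ∈ cthickening (2 * ε₀) (tsupport φ), ‖h z‖ ≤ Bh' :=
      fun z hz => (hBh z hz).trans (le_max_left _ _)
    have hconvn' : ∀ s : Site 2, IsLatticeSite (Λ δ) s →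
        (δ : ℂ) * triEmbed s ∈ cthickening (2 * ε₀) (tsupport φ) →
        ‖hhn s - h ((δ : ℂ) * triEmbed s)‖ < η :=
      fun s hs hsK => hconvn H hH ub wb hbuw sb hsbu hsbw s hs hsK
    have key := one_scale (Λ δ) Fδ (Fδ (b δ)) hhn h φ w A B hHF hL hM hM0 hw hframe hε₀ hn.1
      hn.2.le hexn (le_max_right _ _) hL1n' hNn' (le_max_right _ _) hBhK hη hη1 hconvn' hCΨ
    have hfinal : δ * ((L : ℝ) * C₁' + 24 * M * (Bh' + 1) * N₁') + η * CΨ * N₁' ≤ ε' := by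
      have := hsmall
      rw [← hCst]
      linarith
    exact key.trans hfinal
  ---------------------------------------------------------------- conclusion
  have hXR : Tendsto (fun n => X n + R n) atTop (𝓝 0) := by
    rw [Metric.tendsto_nhds]
    intro ε' hε'
    filter_upwards [hclaim (ε' / 2) (half_pos hε')] with n hn
    rw [dist_zero_right]
    linarith
  have hlim := hXR.sub hR
  rw [zero_sub] at hlim
  refine hlim.congr' (Eventually.of_forall fun n => ?_)
  simp only [hXdef]
  ring


/-- **Registered helper `developingMapLimitHolomorphic_coreLimit`** (crux stmt-CriticalPhenomena-14004, line
`pick-half-plane`, stub `stub_developingMapLimitHolomorphic`): registry form (one `∀`-term) of `core_limit`.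
[folklore] -/
theorem developingMapLimitHolomorphic_coreLimit : ∀ (Λ : ℝ → Finset HexVertex) (e b : ℝ → Sym2 HexVertex) {U : Set ℂ} (hU : IsOpen U) (hexh : ∀ K : Set ℂ, IsCompact K → K ⊆ U → ∀ᶠ δ : ℝ in 𝓝[>] 0, ∀ v : HexVertex, (δ : ℂ) * hexCenter v ∈ K → v ∈ Λ δ) (hbd : ∀ᶠ δ : ℝ in 𝓝[>] 0, hexDomainSimplyConnected (Λ δ) ∧ e δ ∈ hexDomainBoundary (Λ δ) ∧ b δ ∈ hexDomainBoundary (Λ δ)) (hL1 : ∀ K : Set ℂ, IsCompact K → K ⊆ U → ∃ C : ℝ, ∀ᶠ δ : ℝ in 𝓝[>] 0, δ ^ 2 * (∑ᶠ z ∈ {z : Sym2 HexVertex | z ∈ hexDomainMidEdges (Λ δ) ∧ (δ : ℂ) * hexMidpoint z ∈ K}, ‖hexParafermionicObservable (Λ δ) (e δ) hexCriticalFugacity (5 / 8) z‖) ≤ C * ‖hexParafermionicObservable (Λ δ) (e δ) hexCriticalFugacity (5 / 8) (b δ)‖) {ns : ℕ → ℝ} (hns : Tendsto ns atTop (𝓝[>]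 0)) {h : ℂ → ℂ} (hh : ContinuousOn h U) (hconv : ∀ K : Set ℂ, IsCompact K → K ⊆ U → ∀ ε : ℝ, 0 < ε → ∀ᶠ n : ℕ in atTop, ∀ H : Site 2 → ℂ, IsPotential (Λ (ns n)) (e (ns n)) H → ∀ (ub wb : HexVertex), b (ns n) = s(ub, wb) → ∀ sb : Site 2, sb ∈ hexFaceVertices ub → sb ∈ hexFaceVertices wb → ∀ s : Site 2, IsLatticeSite (Λ (ns n)) s → ((ns n : ℝ) : ℂ) * triEmbed s ∈ K → ‖((ns n : ℝ) : ℂ) * (H s - H sb) / hexParafermionicObservable (Λ (ns n)) (e (ns n)) hexCriticalFugacity (5 / 8) (b (ns n)) - h (((ns n : ℝ) : ℂ) * triEmbed s)‖ < ε) {φ : ℂ → ℂ} (hφ : ContDiff ℝ 2 φ) (hφc : HasCompactSupport φ) (hφU : tsupport φ ⊆ U) (w : Fin 6 → ℂ) (hw : ∀ k, ‖w k‖ ≤ 1) (A B : ℂ) (hframe : ∀ P Q : ℂ, ∑ k : Fin 6, w k * (12 * conj (mvec k)) * (P * triEmbed (spoke 0 k) + Q * conj (triEmbed (spoke 0 k)))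 = A * P + B * Q), ∃ ε₀ : ℝ, 0 < ε₀ ∧ (∀ᶠ n : ℕ in atTop, ∀ (s : Site 2) (k : Fin 6), ((ns n : ℝ) : ℂ) * hexMidpoint (edge s k) ∈ cthickening ε₀ (tsupport φ) → s ∈ ((Λ (ns n)).biUnion hexFaceVertices).filter (fun s => ((ns n : ℝ) : ℂ) * triEmbed s ∈ cthickening (2 * ε₀) (tsupport φ)) ∧ face s k ∈ Λ (ns n) ∧ face s (k + 1) ∈ Λ (ns n)) ∧ Tendsto (fun n => ((ns n : ℝ) : ℂ) ^ 2 * ∑ s ∈ ((Λ (ns n)).biUnion hexFaceVertices).filter (fun s => ((ns n : ℝ) : ℂ) * triEmbed s ∈ cthickening (2 * ε₀) (tsupport φ)), ∑ k : Fin 6, φ (((ns n : ℝ) : ℂ) * hexMidpoint (edge s k)) * w k * (hexParafermionicObservable (Λ (ns n)) (e (ns n)) hexCriticalFugacity (5 / 8) (edge s k) / hexParafermionicObservable (Λ (ns n)) (e (ns n)) hexCriticalFugacity (5 / 8) (b (ns n)))) atTop (𝓝 (-(((2 / Real.sqrt 3 : ℝ) : ℂ) * ∫ z, h z * (A * ((2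 : ℂ)⁻¹ * (fderiv ℝ φ z 1 - I * fderiv ℝ φ z I)) + B * dbarAlong 1 φ z)))) :=
  @core_limit

end Summit.CriticalPhenomena.SAWScalingLimit.Theorems.PickHalfPlane.DevelopingMap

end
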